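import Literature.MathematicalPhysics.QuantumFieldTheory.Balaban1983to89.B9Eq326ConjugatedDeltaALetters
import Literature.MathematicalPhysics.QuantumFieldTheory.Balaban1983to89.B9Eq3101ConjugationLettersCurl
import Literature.MathematicalPhysics.QuantumFieldTheory.Balaban1983to89.B9Eq3101ConjugationLettersCoCurl
import Literature.MathematicalPhysics.QuantumFieldTheory.Balaban1983to89.B9Eq326OperatorAssembly

/-!
# `Balaban1983to89.B9Eq326ConjugatedDeltaA` — T. Bałaban, *Propagators for lattice gauge theories in a background field*, Commun. Math. Phys. **99** (1985)
# 389–434 [Balaban1985BackgroundPropagators] (3.26) p. 395, (3.21)∕(3.25) p. 394, (3.10) p. 392, (3.49) p. 399, Thm 3.11 p. 416 with [Balaban1985Variational]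
# (110) p. 294: **THE CONJUGATED BOND PROPAGATOR — `‖e^{κχ}·G₁(U)·e^{−κχ}‖ ≤ 4∕γ` FOR `G₁(U) = Δ_a(U)⁻¹`, `Δ_a(U) = Δ(U) + D_UR(U)D*_U + Q†(a•Q)`**
# (`B9Eq326OperatorAssembly.laplaceAofU` ∕ `G1ofU`), every background with bond variables in the unit balls, every cutoff `χ` with bond increments `≤ ℓη`,
# every `κ` in the windows — the instance of `B9Eq326ConjugatedDeltaALetters` (the PROJECTED square `D_UR(U)D*_U`) at the chain's carrier with the
# curl ∕ cocurl ∕ divergence ∕ gradient conjugation letters DISCHARGED (`B9Eq3101ConjugationLettersCurl`, `…CoCurl`, `…Chain`) and the letters `γ`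
# (Thm 3.11), `p_K`, `β_K` (`Δ′`), `Q`, `ρ` (conjugated `R(U)`), `C_P` (`‖(1 − R(U))D*_U‖`, `B9Eq325ProjectionDivergenceEnergyBound`) displayed — the
# `G₁` twin of the NE9 owner's (D0-c) `B9Eq326ConjugatedLocalPart`; the input of the Cauchy ∕ block-decay kernel for the `L²` block decay of `G₁(U)`

statement-level skeleton of published theorems with citation tags; proofs where landed; nothing here is a claim about the Yang–Mills mass gap

CITATION HEADER (lean-in-tree rule).  Audit cell `pub-balaban`, sub-cell `t4`, BINDER row NE9; filed by NE9 formalisation-swarm leaf prover 03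
(`b2b-balaban-t4-ne9-formalise-leaf-03`, gen 75).  Imports this lineage's `B9Eq326ConjugatedDeltaALetters` (abstract perturbed coercivity with a projected
square), the NE9 owner's `B9Eq3101ConjugationLettersCurl` (curl + divergence letters) and `B9Eq3101ConjugationLettersCoCurl` (cocurl letter) — through them
ne9-leaf-01's `B9Eq3101ConjugationLettersChain` (`norm_adTransportW_le`, the `D_U` letter) and `B9Eq310HessianOperator` (`hessOp`, `principalOpK_eq_comp`,
`adjoint_covCurlL2K`, `curvOp`) — and `B9Eq326OperatorAssembly` (`laplaceAofU`, `RofU`, `G1ofU`).  The proof text follows the owner's (D0-c)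
`B9Eq326ConjugatedLocalPart` letter for letter (CREDIT: t4-ne9-p1 g92), with `D_UD*_U` replaced by `D_UR(U)D*_U`.  Sources READ first-hand
(`paper:balaban1985-cmp99-background-propagators`, journal page = PDF page + 388): p. 395 (3.26), p. 394 (3.21)∕(3.25), p. 392 (3.10), p. 399 (3.49), p. 416
Thm 3.11; [Balaban1985Variational] p. 294 (110).  Print's decay proof is the random walk of Sect. C with local gauge fixing; the conjugation is the ROUTE's
Combes–Thomas substitute (road B8″, as for `G′(U)` in `B9Eq349ConjugatedGreenBlockDecay`); nothing of print's rate is asserted.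

WHAT IS PROVED (sorry-free; proof lane — no `def`; [folklore] composition BY NAME).  Data: the one-step torus `fineP L m`, normed `*`-algebra `𝔸` with fibre
`W ≃ 𝔸` (`φ`, norming constants `M_φ`, `M_φ′`), weight `c₀`, spacing `η > 0`, background `U` with `U(b) ∈ U1` and mutually adjoint transporters `hRS`,
averaging `Q : BondL2K → F`, scalar `a ≥ 0`, trace datum `τ`, `Δ_a(U) = laplaceAofU L m φ η U τ Q a` with its positivity witness `hpos` (Thm 3.11, displayed),
`G₁(U) = G1ofU … hpos`.  Multipliers (linear maps given by their pointwise action): `S`, `S⁻¹` on bonds (`e^{±κχ(b₋)}`), `S_P`, `S_P⁻¹` on plaquettes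
(`e^{±κχ(p₀)}`), `S_S`, `S_S⁻¹` on sites (`e^{±κχ(x)}`).  Letters: coercivity `γ‖f‖² ≤ re⟪f, Δ_a f⟫` (Thm 3.11); remainder floor `re⟪f, Δ′f⟫ ≥ −p_K‖f‖²`;
the conjugated `Q`-letters `‖Q_κ − Q‖, ‖Q′_κ − Q†‖ ≤ β` with `S(Q†(a•Q(S⁻¹f))) = a•Q′_κ(Q_κf)`; the conjugated `Δ′`-letter `‖SΔ′S⁻¹ − Δ′‖ ≤ β_K`; the
conjugated-projection letter `‖S_SR(U)S_S⁻¹ − R(U)‖ ≤ ρ ≤ 1∕8`; the complementary-projection letter `‖D*_Uf − R(U)(D*_Uf)‖ ≤ C_P‖f‖`; windows `‖κ‖ℓη ≤ 1`,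
`4‖κ‖ℓM_φM_φ′·d√d ≤ β`, `4‖κ‖ℓM_φM_φ′·d ≤ β`, `2‖κ‖ℓM_φM_φ′·√d ≤ β`, `p_K∕2 + (21 + 3a)β² + 4βC_P + 2ρC_P² + β_K ≤ γ∕4`.
* §0 pointwise-multiplier bookkeeping (`apply_inv_apply'`, `apply_apply_inv'`), the projection facts `re_inner_RofU_eq` (`re⟪s, R(U)s⟫ = ‖R(U)s‖²`) and
  `norm_RofU_le` (`‖R(U)s‖ ≤ ‖s‖`), `deltaA_structure` (`Δ_af = B₁†(B₁f) + B₂†(R(B₂f)) + Δ′f + a•Q†(Qf)` with `B₁ = covCurlL2K`, `B₂ = covDivL2K`, `R = RofU`),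
  `conjDeltaA_apply` (the conjugated structure), `conjDeltaA_conjInv`.
* §1 **`norm_conjG1ofU_le`** — `‖(S ∘ G₁(U) ∘ S⁻¹)v‖ ≤ (4∕γ)‖v‖`.
HONEST SCOPE.  Composition; `γ`, `p_K`, `β_K`, the `Q` letters, `ρ`, `C_P` displayed (`C_P`'s supplier: `B9Eq325ProjectionDivergenceEnergyBound`; `ρ`'s: the
conjugated-projection difference from `B9Eq349ConjugatedDPChain.norm_Ap_sub_A_le` + the `c`∕`Q̃′`∕`G′` difference letters — next brick); no circle version, no
block decay yet; nothing of [B9] Thm 3.1∕3.3∕3.11 asserted, valued or discharged; «NE9 ⇐ the named binders»; NE9 NOT PRINTED ∕ NOT PROVED; row WALLED ON A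
MODEL (O-NE9-1; #5 UNRULED); spine PROVED 0∕9; rung (B)+1 on a finite T⁴ — NOT infinite volume, NOT mass gap, NOT BetaPertH, NOT Clay.  HONEST DEPENDENCY:
continuum YM on T⁴ ⇐ BetaPertH ∧ nine spine estimates (0/9 proved); BetaPertH ⇐ (D1) ∧ (D4) ∧ CAP+tail.  NEW file; nothing modified.  Net new unproved facts: 0.
-/

noncomputable section

open scoped InnerProductSpace ComplexConjugate BigOperators

namespace Literature.MathematicalPhysics.QuantumFieldTheory.Balaban1983to89.B9Eq326ConjugatedDeltaA

open B4Sect5Torus (TSite)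
open B9SectCLatticeCarrier (Bond bpos btgt)
open B9Eq311L2Pairing (WL2)
open B7Prop1Explicit (U1)
open B9Eq319QprimeTorus (fineP)
open B11Eq103H1Complex (SiteL2K BondL2K greenK apply_greenK covDerivL2K covDivL2K adjoint_covDerivL2K laplaceAK projR projR_projR)
open B9Eq310HessianOperator (adTransportW PlaqL2K covCurlL2K covCoCurlL2K principalOpK curvOp hessOp principalOpK_eq_comp adjoint_covCurlL2K)
open B9Eq3101ConjugationLettersChain (norm_adTransportW_le norm_mulOp_covDerivL2K_adTransportW_sub_le)
open B9Eq3101ConjugationLettersCurl (norm_mulOp_covCurlL2K_sub_le norm_mulOp_covDivL2K_sub_le)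
open B9Eq3101ConjugationLettersCoCurl (norm_mulOp_covCoCurlL2K_sub_le)
open B9Eq326OperatorAssembly (laplaceAofU RofU RofU_isSymmetric G1ofU)
open B9Eq326ConjugatedDeltaALetters (norm_Gk_le_projected)

/-! ## §0 Pointwise multipliers: bookkeeping -/

section Multipliers

variable {X : Type*} {V : Type*} [NormedAddCommGroup V] [InnerProductSpace ℂ V] {w : X → ℝ}

/-- Two maps acting pointwise as `e^{−κχ}` and `e^{κχ}` compose to the identity. [folklore] [cite: Balaban1985BackgroundPropagators, (3.49) p.399] -/
theorem apply_inv_apply' (κ : ℂ) (χ : X → ℝ) {T Tinv : WL2 ℂ w V → WL2 ℂ w V}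
    (hT : ∀ g x, WL2.equiv ℂ w V (T g) x = Complex.exp (κ * (χ x : ℂ)) • WL2.equiv ℂ w V g x)
    (hTinv : ∀ g x, WL2.equiv ℂ w V (Tinv g) x = Complex.exp (-(κ * (χ x : ℂ))) • WL2.equiv ℂ w V g x) (g : WL2 ℂ w V) :
    Tinv (T g) = g := by
  apply (WL2.equiv ℂ w V).injective
  funext x
  rw [hTinv, hT, smul_smul, ← Complex.exp_add, neg_add_cancel, Complex.exp_zero, one_smul]

/-- … and in the other order. [folklore] [cite: Balaban1985BackgroundPropagators, (3.49) p.399] -/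
theorem apply_apply_inv' (κ : ℂ) (χ : X → ℝ) {T Tinv : WL2 ℂ w V → WL2 ℂ w V}
    (hT : ∀ g x, WL2.equiv ℂ w V (T g) x = Complex.exp (κ * (χ x : ℂ)) • WL2.equiv ℂ w V g x)
    (hTinv : ∀ g x, WL2.equiv ℂ w V (Tinv g) x = Complex.exp (-(κ * (χ x : ℂ))) • WL2.equiv ℂ w V g x) (g : WL2 ℂ w V) :
    T (Tinv g) = g := by
  apply (WL2.equiv ℂ w V).injective
  funext x
  rw [hT, hTinv, smul_smul, ← Complex.exp_add, add_neg_cancel, Complex.exp_zero, one_smul]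

end Multipliers

/-! ## §0′ `R(U)` is an orthogonal projection; the structure of `Δ_a` and of its conjugate -/

section Instance

variable {d : ℕ} (L : ℕ) [NeZero L] (m : Fin d → ℕ) {𝔸 : Type*} [NormedRing 𝔸] [StarRing 𝔸] [NormedAlgebra ℂ 𝔸] [StarModule ℂ 𝔸] [NormOneClass 𝔸]
  {W : Type*} [NormedAddCommGroup W] [InnerProductSpace ℂ W] [FiniteDimensional ℂ W] (φ : W ≃ₗ[ℂ] 𝔸) {Mφ Mφ' : ℝ}
  (hφ : ∀ w, ‖φ w‖ ≤ Mφ * ‖w‖) (hφ' : ∀ X, ‖φ.symm X‖ ≤ Mφ' * ‖X‖) (hMφ : 0 ≤ Mφ) (hMφ' : 0 ≤ Mφ')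
  {c₀ : ℝ} [Fact (0 < c₀)] {η : ℝ} (hη : 0 < η) (U : Bond d (fineP L m) → 𝔸ˣ) (hU : ∀ b, U b ∈ U1 𝔸)
  (hRS : ∀ (b : Bond d (fineP L m)) (v u : W), ⟪adTransportW φ U b v, u⟫_ℂ = ⟪v, adTransportW φ (fun b => (U b)⁻¹) b u⟫_ℂ)
  (τ : 𝔸 →ₗ[ℂ] ℂ) {F : Type*} [NormedAddCommGroup F] [InnerProductSpace ℂ F] [FiniteDimensional ℂ F]
  (Q : BondL2K ℂ d (fineP L m) c₀ W →ₗ[ℂ] F) (a : ℝ)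

/-- `conj η⁻¹ = η⁻¹` for the real difference quotient. [folklore] [cite: Balaban1985BackgroundPropagators, (3.3) p.391] -/
theorem conj_inv_eta' (η : ℝ) : (starRingEnd ℂ) ((η : ℂ))⁻¹ = ((η : ℂ))⁻¹ := by rw [map_inv₀, Complex.conj_ofReal]

omit [StarRing 𝔸] [StarModule ℂ 𝔸] [NormOneClass 𝔸] in
/-- `R(U)² = R(U)` (`B11Eq103H1Complex.projR_projR`). [cite: Balaban1985BackgroundPropagators, (3.21) p.394] -/
theorem RofU_RofU (s : SiteL2K ℂ d (fineP L m) c₀ W) :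
    RofU L m φ η U (c₀ := c₀) (RofU L m φ η U (c₀ := c₀) s) = RofU L m φ η U (c₀ := c₀) s := by
  unfold RofU B11Eq103H1Complex.RLatticeK
  exact projR_projR _ _ s

omit [StarRing 𝔸] [StarModule ℂ 𝔸] [NormOneClass 𝔸] in
/-- **`re⟪s, R(U)s⟫ = ‖R(U)s‖²`** — `R(U)` is a symmetric idempotent. [cite: Balaban1985BackgroundPropagators, (3.21) p.394] -/
theorem re_inner_RofU_eq (s : SiteL2K ℂ d (fineP L m) c₀ W) :
    RCLike.re ⟪s, RofU L m φ η U (c₀ := c₀) s⟫_ℂ = ‖RofU L m φ η U (c₀ := c₀) s‖ ^ 2 := by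
  conv_lhs => rw [← RofU_RofU L m φ U s, ← RofU_isSymmetric L m φ η U (c₀ := c₀) s]
  exact inner_self_eq_norm_sq (𝕜 := ℂ) _

omit [StarRing 𝔸] [StarModule ℂ 𝔸] [NormOneClass 𝔸] in
/-- **`‖R(U)s‖ ≤ ‖s‖`.** [cite: Balaban1985BackgroundPropagators, (3.21) p.394] -/
theorem norm_RofU_le (s : SiteL2K ℂ d (fineP L m) c₀ W) : ‖RofU L m φ η U (c₀ := c₀) s‖ ≤ ‖s‖ := by
  have h := re_inner_RofU_eq L m φ (η := η) U s
  have h2 : RCLike.re ⟪s, RofU L m φ η U (c₀ := c₀) s⟫_ℂ ≤ ‖s‖ * ‖RofU L m φ η U (c₀ := c₀) s‖ :=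
    (RCLike.re_le_norm _).trans (norm_inner_le_norm _ _)
  by_cases hx : RofU L m φ η U (c₀ := c₀) s = 0
  · rw [hx, norm_zero]; exact norm_nonneg _
  · have hxpos : 0 < ‖RofU L m φ η U (c₀ := c₀) s‖ := norm_pos_iff.mpr hx
    nlinarith [h, h2, hxpos]

omit [NormOneClass 𝔸] in
include hRS in
/-- **`Δ_a(U)` IN THE SHAPE `B₁†B₁ + B₂†RB₂ + K + aQ†Q`** of `B9Eq326ConjugatedDeltaALetters`: with `B₁ = covCurlL2K` (curl (3.4), transporters `R(U)`),
`B₂ = covDivL2K` (divergence (3.8), transporters `R(U⁻¹)`; `B₂† = D_U` by `adjoint_covDerivL2K`), `R = R(U)` ((3.21)), `K = Δ′ = curvOp`: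
`Δ_af = B₁†(B₁f) + B₂†(R(B₂f)) + Δ′f + a•Q†(Qf)`. [cite: Balaban1985BackgroundPropagators, (3.26) p.395, (3.10) p.392, (3.21) p.394] -/
theorem deltaA_structure (f : BondL2K ℂ d (fineP L m) c₀ W) :
    laplaceAofU L m φ η U τ Q a f =
      LinearMap.adjoint (covCurlL2K ℂ c₀ ((η : ℂ))⁻¹ (adTransportW φ U)) (covCurlL2K ℂ c₀ ((η : ℂ))⁻¹ (adTransportW φ U) f) +
      LinearMap.adjoint (covDivL2K ℂ c₀ ((η : ℂ))⁻¹ (adTransportW φ fun b => (U b)⁻¹))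
        (RofU L m φ η U (c₀ := c₀) (covDivL2K ℂ c₀ ((η : ℂ))⁻¹ (adTransportW φ fun b => (U b)⁻¹) f)) +
      curvOp φ τ η U f + ((a : ℝ) : ℂ) • LinearMap.adjoint Q (Q f) := by
  have h1 : LinearMap.adjoint (covCurlL2K ℂ c₀ ((η : ℂ))⁻¹ (adTransportW φ U)) =
      covCoCurlL2K ℂ c₀ ((η : ℂ))⁻¹ (adTransportW φ fun b => (U b)⁻¹) := adjoint_covCurlL2K _ (conj_inv_eta' η) _ _ hRS
  have h2 : LinearMap.adjoint (covDivL2K ℂ c₀ ((η : ℂ))⁻¹ (adTransportW φ fun b => (U b)⁻¹)) =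
      covDerivL2K ℂ c₀ ((η : ℂ))⁻¹ (adTransportW φ U) := by
    rw [← adjoint_covDerivL2K ((η : ℂ))⁻¹ (conj_inv_eta' η) _ _ hRS, LinearMap.adjoint_adjoint]
  rw [h1, h2]
  unfold laplaceAofU B11Eq103H1Complex.laplaceALatticeK
  rw [laplaceAK, hessOp, principalOpK_eq_comp]
  simp only [LinearMap.add_apply, LinearMap.comp_apply, LinearMap.smul_apply, map_smul]
  abel

variable {κ : ℂ} {χ : TSite d (fineP L m) → ℝ}
  {S Sinv : BondL2K ℂ d (fineP L m) c₀ W →ₗ[ℂ] BondL2K ℂ d (fineP L m) c₀ W}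
  (hS : ∀ (g : BondL2K ℂ d (fineP L m) c₀ W) (b : Bond d (fineP L m)),
    WL2.equiv ℂ (fun _ : Bond d (fineP L m) => c₀) W (S g) b =
      Complex.exp (κ * (χ (bpos b) : ℂ)) • WL2.equiv ℂ (fun _ : Bond d (fineP L m) => c₀) W g b)
  (hSinv : ∀ (g : BondL2K ℂ d (fineP L m) c₀ W) (b : Bond d (fineP L m)),
    WL2.equiv ℂ (fun _ : Bond d (fineP L m) => c₀) W (Sinv g) b =
      Complex.exp (-(κ * (χ (bpos b) : ℂ))) • WL2.equiv ℂ (fun _ : Bond d (fineP L m) => c₀) W g b)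
  {SP SPinv : PlaqL2K ℂ d (fineP L m) c₀ W →ₗ[ℂ] PlaqL2K ℂ d (fineP L m) c₀ W}
  (hSP : ∀ (g : PlaqL2K ℂ d (fineP L m) c₀ W) (p : B9SectCLatticeCarrier.Plaq d (fineP L m)),
    WL2.equiv ℂ (fun _ : B9SectCLatticeCarrier.Plaq d (fineP L m) => c₀) W (SP g) p =
      Complex.exp (κ * (χ p.1 : ℂ)) • WL2.equiv ℂ (fun _ : B9SectCLatticeCarrier.Plaq d (fineP L m) => c₀) W g p)
  (hSPinv : ∀ (g : PlaqL2K ℂ d (fineP L m) c₀ W) (p : B9SectCLatticeCarrier.Plaq d (fineP L m)),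
    WL2.equiv ℂ (fun _ : B9SectCLatticeCarrier.Plaq d (fineP L m) => c₀) W (SPinv g) p =
      Complex.exp (-(κ * (χ p.1 : ℂ))) • WL2.equiv ℂ (fun _ : B9SectCLatticeCarrier.Plaq d (fineP L m) => c₀) W g p)
  {SS SSinv : SiteL2K ℂ d (fineP L m) c₀ W →ₗ[ℂ] SiteL2K ℂ d (fineP L m) c₀ W}
  (hSS : ∀ (g : SiteL2K ℂ d (fineP L m) c₀ W) (x : TSite d (fineP L m)),
    WL2.equiv ℂ (fun _ : TSite d (fineP L m) => c₀) W (SS g) x =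
      Complex.exp (κ * (χ x : ℂ)) • WL2.equiv ℂ (fun _ : TSite d (fineP L m) => c₀) W g x)
  (hSSinv : ∀ (g : SiteL2K ℂ d (fineP L m) c₀ W) (x : TSite d (fineP L m)),
    WL2.equiv ℂ (fun _ : TSite d (fineP L m) => c₀) W (SSinv g) x =
      Complex.exp (-(κ * (χ x : ℂ))) • WL2.equiv ℂ (fun _ : TSite d (fineP L m) => c₀) W g x)

omit [NormOneClass 𝔸] in
include hRS hSP hSPinv hSS hSSinv in
/-- **THE CONJUGATED `Δ_a` HAS THE CONJUGATED STRUCTURE**: with `B_{1,κ} = S_P∘curl∘S⁻¹`, `B′_{1,κ} = S∘cocurl∘S_P⁻¹`, `B_{2,κ} = S_S∘D*∘S⁻¹`, `R_κ = S_S∘R(U)∘S_S⁻¹`,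
`B′_{2,κ} = S∘D∘S_S⁻¹`, `K_κ = S∘Δ′∘S⁻¹` and any factorisation `S(Q†(a•Q(S⁻¹f))) = a•Q′_κ(Q_κf)`:
`(S∘Δ_a∘S⁻¹)f = B′_{1,κ}(B_{1,κ}f) + B′_{2,κ}(R_κ(B_{2,κ}f)) + K_κf + a•Q′_κ(Q_κf)` (insert `S_P⁻¹S_P = 1`, `S_S⁻¹S_S = 1` twice).
[cite: Balaban1985BackgroundPropagators, (3.26) p.395, (3.49) p.399] -/
theorem conjDeltaA_apply (Qk : BondL2K ℂ d (fineP L m) c₀ W →ₗ[ℂ] F) (Qk' : F →ₗ[ℂ] BondL2K ℂ d (fineP L m) c₀ W)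
    (hQfac : ∀ f, S (LinearMap.adjoint Q (((a : ℝ) : ℂ) • Q (Sinv f))) = ((a : ℝ) : ℂ) • Qk' (Qk f)) (f : BondL2K ℂ d (fineP L m) c₀ W) :
    (S ∘ₗ laplaceAofU L m φ η U τ Q a ∘ₗ Sinv) f =
      (S ∘ₗ covCoCurlL2K ℂ c₀ ((η : ℂ))⁻¹ (adTransportW φ fun b => (U b)⁻¹) ∘ₗ SPinv)
          ((SP ∘ₗ covCurlL2K ℂ c₀ ((η : ℂ))⁻¹ (adTransportW φ U) ∘ₗ Sinv) f) +
        (S ∘ₗ covDerivL2K ℂ c₀ ((η : ℂ))⁻¹ (adTransportW φ U) ∘ₗ SSinv)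
          ((SS ∘ₗ RofU L m φ η U (c₀ := c₀) ∘ₗ SSinv) ((SS ∘ₗ covDivL2K ℂ c₀ ((η : ℂ))⁻¹ (adTransportW φ fun b => (U b)⁻¹) ∘ₗ Sinv) f)) +
        (S ∘ₗ curvOp φ τ η U ∘ₗ Sinv) f + ((a : ℝ) : ℂ) • Qk' (Qk f) := by
  have hP : ∀ g, SPinv (SP g) = g := apply_inv_apply' κ (fun p : B9SectCLatticeCarrier.Plaq d (fineP L m) => χ p.1) hSP hSPinv
  have hSi : ∀ g, SSinv (SS g) = g := apply_inv_apply' κ χ hSS hSSinv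
  have h1 : LinearMap.adjoint (covCurlL2K ℂ c₀ ((η : ℂ))⁻¹ (adTransportW φ U)) =
      covCoCurlL2K ℂ c₀ ((η : ℂ))⁻¹ (adTransportW φ fun b => (U b)⁻¹) := adjoint_covCurlL2K _ (conj_inv_eta' η) _ _ hRS
  have h2 : LinearMap.adjoint (covDivL2K ℂ c₀ ((η : ℂ))⁻¹ (adTransportW φ fun b => (U b)⁻¹)) =
      covDerivL2K ℂ c₀ ((η : ℂ))⁻¹ (adTransportW φ U) := by
    rw [← adjoint_covDerivL2K ((η : ℂ))⁻¹ (conj_inv_eta' η) _ _ hRS, LinearMap.adjoint_adjoint]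
  simp only [LinearMap.comp_apply, hP, hSi]
  rw [deltaA_structure L m φ (η := η) U hRS τ Q a (Sinv f), h1, h2, ← hQfac]
  simp only [map_add, map_smul]

omit [NormOneClass 𝔸] in
include hS hSinv in
/-- **`(S∘Δ_a∘S⁻¹)(S∘G₁∘S⁻¹) = 1`** (`S⁻¹S = 1`, `SS⁻¹ = 1`, `Δ_aG₁ = 1`). [cite: Balaban1985BackgroundPropagators, (3.26) p.395, Thm 3.11 p.416; Balaban1985Variational, (110) p.294] -/
theorem conjDeltaA_conjInv
    (hpos : ∀ x : BondL2K ℂ d (fineP L m) c₀ W, x ≠ 0 → 0 < RCLike.re ⟪x, laplaceAofU L m φ η U τ Q a x⟫_ℂ)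
    (v : BondL2K ℂ d (fineP L m) c₀ W) :
    (S ∘ₗ laplaceAofU L m φ η U τ Q a ∘ₗ Sinv) ((S ∘ₗ G1ofU L m φ η U τ hpos ∘ₗ Sinv) v) = v := by
  simp only [LinearMap.comp_apply]
  rw [apply_inv_apply' κ (fun b : Bond d (fineP L m) => χ (bpos b)) hS hSinv]
  unfold G1ofU B11Eq103H1Complex.G1LatticeK B11Eq103H1Complex.G1K laplaceAofU B11Eq103H1Complex.laplaceALatticeK
  rw [apply_greenK, apply_apply_inv' κ (fun b : Bond d (fineP L m) => χ (bpos b)) hS hSinv]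

/-! ## §1 `‖S G₁(U) S⁻¹‖ ≤ 4∕γ` -/

include hφ hφ' hMφ hMφ' hη hU hRS hS hSinv hSP hSPinv hSS hSSinv in
/-- **THE CONJUGATED BOND PROPAGATOR IS BOUNDED: `‖(S∘G₁(U)∘S⁻¹)v‖ ≤ (4∕γ)‖v‖`.**  `B9Eq326ConjugatedDeltaALetters.norm_Gk_le_projected` at the chain's
`Δ_a(U) = Δ(U) + D_UR(U)D*_U + Q†(a•Q)` with: `γ`-coercivity of `Δ_a` (Thm 3.11; displayed), the `Δ′` floor `re⟪f, Δ′f⟫ ≥ −p_K‖f‖²` (displayed), the curl ∕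
cocurl ∕ divergence ∕ gradient conjugation letters DISCHARGED (`B9Eq3101ConjugationLettersCurl` ∕ `…CoCurl` ∕ `…Chain` with `M_T = M_φM_φ′` for bond variables
in the unit balls) in the windows `‖κ‖ℓη ≤ 1`, `4‖κ‖ℓM_φM_φ′d√d ≤ β`, `4‖κ‖ℓM_φM_φ′d ≤ β`, `2‖κ‖ℓM_φM_φ′√d ≤ β`, the conjugated `Q` and `Δ′` letters displayed,
the conjugated-projection letter `‖S_SR(U)S_S⁻¹ − R(U)‖ ≤ ρ ≤ 1∕8` and the complementary-projection letter `‖(1 − R(U))D*_U‖ ≤ C_P` displayed, and the window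
`p_K∕2 + (21 + 3a)β² + 4βC_P + 2ρC_P² + β_K ≤ γ∕4` — every `U`, `χ`, `κ` of the letters, NO `η`, NO volume.
[cite: Balaban1985BackgroundPropagators, (3.26) p.395, (3.21) p.394, (3.49) p.399, Thm 3.11 p.416; Balaban1985Variational, (110) p.294] -/
theorem norm_conjG1ofU_le (ha : 0 ≤ a)
    (hpos : ∀ x : BondL2K ℂ d (fineP L m) c₀ W, x ≠ 0 → 0 < RCLike.re ⟪x, laplaceAofU L m φ η U τ Q a x⟫_ℂ)
    {γ β βK pK ℓ ρ CP : ℝ} (hγ : 0 < γ) (hβ : 0 ≤ β) (hℓ : 0 ≤ ℓ) (hρ : 0 ≤ ρ) (hρ8 : ρ ≤ 1 / 8) (hCP : 0 ≤ CP)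
    (hcoer : ∀ f : BondL2K ℂ d (fineP L m) c₀ W, γ * ‖f‖ ^ 2 ≤ RCLike.re ⟪f, laplaceAofU L m φ η U τ Q a f⟫_ℂ)
    (hKre : ∀ f : BondL2K ℂ d (fineP L m) c₀ W, -(pK * ‖f‖ ^ 2) ≤ RCLike.re ⟪f, curvOp φ τ η U f⟫_ℂ)
    (hχ : ∀ b : Bond d (fineP L m), |χ (bpos b) - χ (btgt b)| ≤ ℓ * η) (hwin : ‖κ‖ * ℓ * η ≤ 1)
    (hβCC : 4 * ‖κ‖ * ℓ * (Mφ * Mφ') * (d * Real.sqrt d) ≤ β) (hβC : 4 * ‖κ‖ * ℓ * (Mφ * Mφ') * d ≤ β)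
    (hβD : 2 * ‖κ‖ * ℓ * (Mφ * Mφ') * Real.sqrt d ≤ β)
    (Qk : BondL2K ℂ d (fineP L m) c₀ W →ₗ[ℂ] F) (Qk' : F →ₗ[ℂ] BondL2K ℂ d (fineP L m) c₀ W)
    (hQfac : ∀ f, S (LinearMap.adjoint Q (((a : ℝ) : ℂ) • Q (Sinv f))) = ((a : ℝ) : ℂ) • Qk' (Qk f))
    (dQ : ∀ f, ‖Qk f - Q f‖ ≤ β * ‖f‖) (dQ' : ∀ g, ‖Qk' g - LinearMap.adjoint Q g‖ ≤ β * ‖g‖)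
    (dK : ∀ f, ‖(S ∘ₗ curvOp φ τ η U ∘ₗ Sinv) f - curvOp φ τ η U f‖ ≤ βK * ‖f‖)
    (dR : ∀ s, ‖(SS ∘ₗ RofU L m φ η U (c₀ := c₀) ∘ₗ SSinv) s - RofU L m φ η U (c₀ := c₀) s‖ ≤ ρ * ‖s‖)
    (hP : ∀ f, ‖covDivL2K ℂ c₀ ((η : ℂ))⁻¹ (adTransportW φ fun b => (U b)⁻¹) f -
      RofU L m φ η U (c₀ := c₀) (covDivL2K ℂ c₀ ((η : ℂ))⁻¹ (adTransportW φ fun b => (U b)⁻¹) f)‖ ≤ CP * ‖f‖)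
    (small : pK / 2 + (21 + 3 * a) * β ^ 2 + 4 * β * CP + 2 * ρ * CP ^ 2 + βK ≤ γ / 4) (v : BondL2K ℂ d (fineP L m) c₀ W) :
    ‖(S ∘ₗ G1ofU L m φ η U τ hpos ∘ₗ Sinv) v‖ ≤ 4 / γ * ‖v‖ := by
  -- transporter bounds `M_T = M_φM_φ′` for `R(U)` and `R(U⁻¹)`
  have hR : ∀ (b : Bond d (fineP L m)) (w : W), ‖adTransportW φ U b w‖ ≤ Mφ * Mφ' * ‖w‖ :=
    fun b w => norm_adTransportW_le φ hφ hφ' hMφ' U b (hU b) w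
  have hSad : ∀ (b : Bond d (fineP L m)) (w : W), ‖adTransportW φ (fun b => (U b)⁻¹) b w‖ ≤ Mφ * Mφ' * ‖w‖ :=
    fun b w => norm_adTransportW_le φ hφ hφ' hMφ' (fun b => (U b)⁻¹) b ((U1 𝔸).inv_mem (hU b)) w
  have hMT : 0 ≤ Mφ * Mφ' := mul_nonneg hMφ hMφ'
  have hθ : 0 ≤ ℓ * η := mul_nonneg hℓ hη.le
  have hwin' : ‖κ‖ * (ℓ * η) ≤ 1 := by simpa [mul_assoc] using hwin
  have hcθ : ‖((η : ℂ))⁻¹‖ * (ℓ * η) = ℓ := by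
    rw [norm_inv, Complex.norm_real, Real.norm_eq_abs, abs_of_pos hη]; field_simp
  -- adjoints of the two first-order letters
  have h1 : LinearMap.adjoint (covCurlL2K ℂ c₀ ((η : ℂ))⁻¹ (adTransportW φ U)) =
      covCoCurlL2K ℂ c₀ ((η : ℂ))⁻¹ (adTransportW φ fun b => (U b)⁻¹) := adjoint_covCurlL2K _ (conj_inv_eta' η) _ _ hRS
  have h2 : LinearMap.adjoint (covDivL2K ℂ c₀ ((η : ℂ))⁻¹ (adTransportW φ fun b => (U b)⁻¹)) =
      covDerivL2K ℂ c₀ ((η : ℂ))⁻¹ (adTransportW φ U) := by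
    rw [← adjoint_covDerivL2K ((η : ℂ))⁻¹ (conj_inv_eta' η) _ _ hRS, LinearMap.adjoint_adjoint]
  -- the four discharged letters
  have dB₁ : ∀ f, ‖(SP ∘ₗ covCurlL2K ℂ c₀ ((η : ℂ))⁻¹ (adTransportW φ U) ∘ₗ Sinv) f - covCurlL2K ℂ c₀ ((η : ℂ))⁻¹ (adTransportW φ U) f‖ ≤ β * ‖f‖ := by
    intro f
    have h := norm_mulOp_covCurlL2K_sub_le hθ hMT hR hχ hwin' ((η : ℂ))⁻¹ SP hSP Sinv hSinv f
    simp only [LinearMap.comp_apply]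
    refine h.trans ?_
    calc 4 * ‖((η : ℂ))⁻¹‖ * ‖κ‖ * (ℓ * η) * (Mφ * Mφ') * d * ‖f‖ = 4 * ‖κ‖ * ℓ * (Mφ * Mφ') * d * ‖f‖ := by
          rw [show 4 * ‖((η : ℂ))⁻¹‖ * ‖κ‖ * (ℓ * η) = 4 * ‖κ‖ * (‖((η : ℂ))⁻¹‖ * (ℓ * η)) by ring, hcθ]
      _ ≤ β * ‖f‖ := mul_le_mul_of_nonneg_right hβC (norm_nonneg _)
  have dB₁' : ∀ p, ‖(S ∘ₗ covCoCurlL2K ℂ c₀ ((η : ℂ))⁻¹ (adTransportW φ fun b => (U b)⁻¹) ∘ₗ SPinv) p -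
      LinearMap.adjoint (covCurlL2K ℂ c₀ ((η : ℂ))⁻¹ (adTransportW φ U)) p‖ ≤ β * ‖p‖ := by
    intro p
    rw [h1]
    have h := norm_mulOp_covCoCurlL2K_sub_le hθ hMT hSad hχ hwin' ((η : ℂ))⁻¹ S hS SPinv hSPinv p
    simp only [LinearMap.comp_apply]
    refine h.trans ?_
    calc 4 * ‖((η : ℂ))⁻¹‖ * ‖κ‖ * (ℓ * η) * (Mφ * Mφ') * (d * Real.sqrt d) * ‖p‖ = 4 * ‖κ‖ * ℓ * (Mφ * Mφ') * (d * Real.sqrt d) * ‖p‖ := by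
          rw [show 4 * ‖((η : ℂ))⁻¹‖ * ‖κ‖ * (ℓ * η) = 4 * ‖κ‖ * (‖((η : ℂ))⁻¹‖ * (ℓ * η)) by ring, hcθ]
      _ ≤ β * ‖p‖ := mul_le_mul_of_nonneg_right hβCC (norm_nonneg _)
  have dB₂ : ∀ f, ‖(SS ∘ₗ covDivL2K ℂ c₀ ((η : ℂ))⁻¹ (adTransportW φ fun b => (U b)⁻¹) ∘ₗ Sinv) f -
      covDivL2K ℂ c₀ ((η : ℂ))⁻¹ (adTransportW φ fun b => (U b)⁻¹) f‖ ≤ β * ‖f‖ := by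
    intro f
    have h := norm_mulOp_covDivL2K_sub_le hθ hMT hSad hχ hwin' ((η : ℂ))⁻¹ SS hSS Sinv hSinv f
    simp only [LinearMap.comp_apply]
    refine h.trans ?_
    calc 2 * ‖((η : ℂ))⁻¹‖ * ‖κ‖ * (ℓ * η) * (Mφ * Mφ') * Real.sqrt d * ‖f‖ = 2 * ‖κ‖ * ℓ * (Mφ * Mφ') * Real.sqrt d * ‖f‖ := by
          rw [show 2 * ‖((η : ℂ))⁻¹‖ * ‖κ‖ * (ℓ * η) = 2 * ‖κ‖ * (‖((η : ℂ))⁻¹‖ * (ℓ * η)) by ring, hcθ]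
      _ ≤ β * ‖f‖ := mul_le_mul_of_nonneg_right hβD (norm_nonneg _)
  have dB₂' : ∀ s, ‖(S ∘ₗ covDerivL2K ℂ c₀ ((η : ℂ))⁻¹ (adTransportW φ U) ∘ₗ SSinv) s -
      LinearMap.adjoint (covDivL2K ℂ c₀ ((η : ℂ))⁻¹ (adTransportW φ fun b => (U b)⁻¹)) s‖ ≤ β * ‖s‖ := by
    intro s
    rw [h2]
    have h := norm_mulOp_covDerivL2K_adTransportW_sub_le φ hφ hφ' hMφ hMφ' hη hℓ U hU hχ hwin S hS SSinv hSSinv s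
    simp only [LinearMap.comp_apply]
    exact h.trans (mul_le_mul_of_nonneg_right hβD (norm_nonneg _))
  -- the projection facts, the structure, the conjugated structure, the inverse
  have hRsq := re_inner_RofU_eq L m φ (η := η) (c₀ := c₀) U
  have hR1 := norm_RofU_le L m φ (η := η) (c₀ := c₀) U
  have hH := deltaA_structure L m φ (η := η) U hRS τ Q a
  have hHk := conjDeltaA_apply L m φ (η := η) U hRS τ Q a (κ := κ) (χ := χ) (S := S) (Sinv := Sinv) hSP hSPinv hSS hSSinv Qk Qk' hQfac
  have hHkGk := conjDeltaA_conjInv L m φ U τ Q a (κ := κ) (χ := χ) hS hSinv hpos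
  exact norm_Gk_le_projected (covCurlL2K ℂ c₀ ((η : ℂ))⁻¹ (adTransportW φ U)) (covDivL2K ℂ c₀ ((η : ℂ))⁻¹ (adTransportW φ fun b => (U b)⁻¹))
    (RofU L m φ η U (c₀ := c₀)) Q (curvOp φ τ η U) (laplaceAofU L m φ η U τ Q a) a γ β βK pK ρ CP _ _ _ _
    (SS ∘ₗ RofU L m φ η U (c₀ := c₀) ∘ₗ SSinv) Qk Qk' (S ∘ₗ curvOp φ τ η U ∘ₗ Sinv) (S ∘ₗ laplaceAofU L m φ η U τ Q a ∘ₗ Sinv)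
    (S ∘ₗ G1ofU L m φ η U τ hpos ∘ₗ Sinv)
    ha hγ hβ hρ hCP hRsq hR1 hH hcoer hKre dB₁ dB₁' dB₂ dB₂' dR dQ dQ' dK small hHk hHkGk hρ8 hP v

end Instance

end Literature.MathematicalPhysics.QuantumFieldTheory.Balaban1983to89.B9Eq326ConjugatedDeltaA

end
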